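import Mathlib.MeasureTheory.Integral.IntervalIntegral.Basic
import Literature.Geometry.Riemannian.LiQingShiPinching
import HarnessLib

/-!
# Li–Qing–Shi 2017, Thm. 1.8 at `n = 5`: decomposition along the printed proof

Fact-decomposition file (librarian, mode `fact-decompose`, 2026-08-16) for the named fact
`Literature.Geometry.Riemannian.liQingShi_pinching_five` (`LiQingShiPinching.lean`; G. Li,
J. Qing, Y. Shi, *Gap phenomena and curvature estimates for conformally compact Einstein
manifolds*, Trans. AMS 369 (2017) 4385–4413 = arXiv:1410.6402, Thm. 1.8 at bulk dimension
`n = 5`). The printed proof of Thm. 1.8 (arXiv pp. 12–13) has exactly two layers, and the Yamabe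
hypothesis enters only through the first:

1. **Thm. 1.5 (relative volume inequality)**, arXiv p. 3: for an AH manifold `(Xⁿ, g⁺)` of
   `C³` regularity with `Ric ≥ -(n-1)` and conformal infinity of nonnegative Yamabe type,
   `(Y(∂X,[ĝ]) / Y(S^{n-1},[g_S]))^{(n-1)/2} ≤ Vol(∂B_{g⁺}(p,t)) / Vol(∂B_ℍ(t))
     ≤ Vol(B_{g⁺}(p,t)) / Vol(B_ℍ(t)) ≤ 1` for every `p ∈ X`, `t > 0`
   (proved in §§4–6; for a conformally compact EINSTEIN `g⁺` of `C²` regularity the `C³`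
   asymptotic hyperbolicity is supplied by Chruściel–Delay–Lee–Skinner, as the paper notes in §2).
   Child `liQingShi_volumeComparison_five` below is its `n = 5` instance in the hypothesis form of
   the parent: `Y(M,[g₀]) ≥ (1-δ)·Y(S⁴)` with `0 < δ ≤ 1` gives
   `Vol_g(B_g(p,t)) ≥ (1-δ)² V_ℍ(t)`, `V_ℍ(t) = ω₄ ∫₀ᵗ sinh⁴ s ds`, `ω₄ = 8π²/3`.
2. **The curvature gap from the volume gap** (proof of Thm. 1.8, pp. 12–13, Steps 1–2: a
   uniform bound `|W| ≤ C` by rescaling at the maximum of `|W|` and Cheeger–Gromov–Anderson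
   convergence to a Ricci-flat limit with almost Euclidean volume growth, hence flat; then a
   second compactness argument whose Einstein limit has hyperbolic volume ratio `≡ 1`, hence is
   `ℍⁿ`, contradicting `|W|(p_∞) ≥ ε₀`): for every `ε > 0` there is `δ' > 0` such that every
   conformally compact Einstein `(N⁵, g)` with `Vol_g(B_g(p,t)) ≥ (1-δ') V_ℍ(t)` for all `p, t`
   has all sectional curvatures within `ε` of `-1`. Child `liQingShi_curvatureGap_five`.

`liQingShi_pinching_five_holds_of` PROVES the parent from the two children (choose
`δ = min(δ'/2, 1)`, so that `(1-δ)² ≥ 1-δ'`). Neither child restates the parent: (1) is a volume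
statement with no curvature conclusion, (2) has no conformal-infinity / Yamabe hypothesis.
Vocabulary: geodesic balls are the balls of Mathlib's length distance `riemannianEDist` for the
Riemannian bundle structure of `g` (the structure inside `riemannianMeasure g`, `Volume.lean`), so
that ball and measure refer to the same metric; the bulk `N` carries its Borel σ-algebra
(binders `[T3Space N] [MeasurableSpace N] [BorelSpace N]`, manufactured in the assembly).
The analytic core of layer 1 (§6, Riccati comparison) is already proved in
`AHRiccatiEstimates.lean`; the pointwise dictionary `|K+1| = |W_{ijji}|` of layer 2 in
`LiQingShiPinchingProofs.lean`.

## References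

* [LiQingShi2017] G. Li, J. Qing, Y. Shi, Trans. AMS 369 (2017), arXiv:1410.6402: Thm. 1.5
  (p. 3), Thm. 1.8 (p. 4) and its proof (pp. 12–13), §2 (regularity).
* M. T. Anderson, *Convergence and rigidity of manifolds under Ricci curvature bounds*, Invent.
  Math. 102 (1990) 429–445, Lemma 3.1 / Gap Lemma (volume pinching ⇒ flatness for Ricci-flat
  manifolds), used in Step 1.
-/

noncomputable section

open MeasureTheory Bundle
open scoped Manifold ContDiff ENNReal

namespace Literature.Geometry.Riemannian

open Literature.Geometry.Lorentzian (PseudoRiemannianMetric riemannianMeasure)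
open Literature.Geometry.Lorentzian.PseudoRiemannianMetric

/-- **Li–Qing–Shi 2017, Thm. 1.5 at `n = 5`, lower bound, ball form (child 1 of
`liQingShi_pinching_five`).** Printed (arXiv:1410.6402, p. 3): for an AH `(Xⁿ, g⁺)` of `C³`
regularity with `Ric[g⁺] ≥ -(n-1)g⁺`,
`(Y(∂X,[ĝ])/Y(S^{n-1},[g_S]))^{(n-1)/2} ≤ Vol(∂B_{g⁺}(p,t))/Vol(∂B_ℍ(t)) ≤ Vol(B_{g⁺}(p,t))/Vol(B_ℍ(t)) ≤ 1`.
Here, for a Poincaré–Einstein filling `(N⁵, g)` of a closed `(M⁴, [g₀])`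
(`IsPoincareEinsteinFilling`, Def. 2.1; Einstein `C²`-conformally compact metrics are `C³`-AH by
the boundary regularity of §2) whose conformal infinity satisfies
`(1-δ)·8√6π·√Vol(M,h) ≤ ∫_M R_h dV_h` for all `h` conformal to `g₀` (i.e.
`Y(M,[g₀]) ≥ (1-δ) Y(S⁴)`, `0 < δ ≤ 1`, the hypothesis of the parent): for every `p ∈ N` and
`t > 0`, `(1-δ)² · (8π²/3) ∫₀ᵗ sinh⁴ s ds ≤ Vol_g(B_g(p, t))`, where `B_g(p,t)` is the ball of the
length distance of `g` and `Vol_g` the Riemannian measure (`riemannianMeasure g`); the middle and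
right inequalities of (1.7) are not restated. [cite: LiQingShi2017, Thm. 1.5 (arXiv p. 3) with §2] -/
def liQingShi_volumeComparison_five : Prop :=
  ∀ δ : ℝ, 0 < δ → δ ≤ 1 →
    ∀ (M : Type) [TopologicalSpace M] [T2Space M] [SecondCountableTopology M]
      [ChartedSpace (EuclideanSpace ℝ (Fin 4)) M] [IsManifold (𝓡 4) ∞ M] [CompactSpace M]
      [ConnectedSpace M] [MeasurableSpace M] [BorelSpace M]
      (g₀ : Bundle.ContMDiffRiemannianMetric (𝓡 4) ∞ (EuclideanSpace ℝ (Fin 4))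
        (TangentSpace (𝓡 4) : M → Type _))
      (N : Type) [TopologicalSpace N] [T2Space N] [SecondCountableTopology N]
      [ChartedSpace (EuclideanSpace ℝ (Fin 5)) N] [IsManifold (𝓡 5) ∞ N]
      [T3Space N] [MeasurableSpace N] [BorelSpace N]
      (g : Bundle.ContMDiffRiemannianMetric (𝓡 5) ∞ (EuclideanSpace ℝ (Fin 5))
        (TangentSpace (𝓡 5) : N → Type _))
      [(PseudoRiemannianMetric.ofRiemannian g).HasLeviCivita],
      IsPoincareEinsteinFilling M g₀ N g →
      (∀ (h : Bundle.ContMDiffRiemannianMetric (𝓡 4) ∞ (EuclideanSpace ℝ (Fin 4))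
          (TangentSpace (𝓡 4) : M → Type _))
          [(PseudoRiemannianMetric.ofRiemannian h).HasLeviCivita],
        IsConformalTo h g₀ →
          (1 - δ) * (8 * Real.sqrt 6 * Real.pi) *
              Real.sqrt ((riemannianMeasure h Set.univ).toReal) ≤
            ∫ x, (PseudoRiemannianMetric.ofRiemannian h).scalarCurvature x
              ∂(riemannianMeasure h)) →
      ∀ (p : N) (t : ℝ), 0 < t →
        ENNReal.ofReal ((1 - δ) ^ 2 *
            ((8 * Real.pi ^ 2 / 3) * ∫ s in (0 : ℝ)..t, Real.sinh s ^ 4)) ≤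
          riemannianMeasure g
            {y : N | (letI : RiemannianBundle (fun x : N ↦ TangentSpace (𝓡 5) x) :=
                ⟨g.toContinuousRiemannianMetric.toRiemannianMetric⟩
              Manifold.riemannianEDist (𝓡 5) p y) < ENNReal.ofReal t}

/-- **Li–Qing–Shi 2017, proof of Thm. 1.8 at `n = 5`, Steps 1–2: the curvature gap from the
volume gap (child 2 of `liQingShi_pinching_five`).** For every `ε > 0` there is `δ' > 0` such
that every Poincaré–Einstein filling `(N⁵, g)` of a closed `(M⁴,[g₀])` (`Ric_g = -4g`,
`C²`-conformally compact, Def. 2.1) all of whose geodesic balls satisfy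
`(1-δ') · (8π²/3) ∫₀ᵗ sinh⁴ s ds ≤ Vol_g(B_g(p,t))` (`p ∈ N`, `t > 0`; hyperbolic volume ratio
`≥ 1-δ'`) has `|Rm_g(X,Y,Y,X) + 1| ≤ ε` for every `g`-orthonormal pair `X, Y` at every point (all
sectional curvatures within `ε` of `-1`). This is what pp. 12–13 of arXiv:1410.6402 prove by
contradiction: Step 1, a uniform Weyl bound via rescaling at the maximum of `|W|` and a
Ricci-flat limit with volume ratio `≥ 1-δ'`, flat by Anderson's gap lemma; Step 2, a second
Cheeger–Gromov–Anderson limit, Einstein with hyperbolic volume ratio `≡ 1`, hence `ℍ⁵`,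
contradicting `|W|(p_∞) ≥ ε₀` — the Yamabe constant of the conformal infinity enters the printed
proof only through the volume bound of Thm. 1.5 (child 1).
[cite: LiQingShi2017, Thm. 1.8, proof, Steps 1–2 (arXiv pp. 12–13)] -/
def liQingShi_curvatureGap_five : Prop :=
  ∀ ε : ℝ, 0 < ε → ∃ δ' : ℝ, 0 < δ' ∧
    ∀ (M : Type) [TopologicalSpace M] [T2Space M] [SecondCountableTopology M]
      [ChartedSpace (EuclideanSpace ℝ (Fin 4)) M] [IsManifold (𝓡 4) ∞ M] [CompactSpace M]
      [ConnectedSpace M] [MeasurableSpace M] [BorelSpace M]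
      (g₀ : Bundle.ContMDiffRiemannianMetric (𝓡 4) ∞ (EuclideanSpace ℝ (Fin 4))
        (TangentSpace (𝓡 4) : M → Type _))
      (N : Type) [TopologicalSpace N] [T2Space N] [SecondCountableTopology N]
      [ChartedSpace (EuclideanSpace ℝ (Fin 5)) N] [IsManifold (𝓡 5) ∞ N]
      [T3Space N] [MeasurableSpace N] [BorelSpace N]
      (g : Bundle.ContMDiffRiemannianMetric (𝓡 5) ∞ (EuclideanSpace ℝ (Fin 5))
        (TangentSpace (𝓡 5) : N → Type _))
      [(PseudoRiemannianMetric.ofRiemannian g).HasLeviCivita],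
      IsPoincareEinsteinFilling M g₀ N g →
      (∀ (p : N) (t : ℝ), 0 < t →
        ENNReal.ofReal ((1 - δ') *
            ((8 * Real.pi ^ 2 / 3) * ∫ s in (0 : ℝ)..t, Real.sinh s ^ 4)) ≤
          riemannianMeasure g
            {y : N | (letI : RiemannianBundle (fun x : N ↦ TangentSpace (𝓡 5) x) :=
                ⟨g.toContinuousRiemannianMetric.toRiemannianMetric⟩
              Manifold.riemannianEDist (𝓡 5) p y) < ENNReal.ofReal t}) →
      ∀ (x : N) (X Y : TangentSpace (𝓡 5) x), g.inner x X X = 1 → g.inner x Y Y = 1 →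
        g.inner x X Y = 0 →
        |(PseudoRiemannianMetric.ofRiemannian g).curvatureForm
            (PseudoRiemannianMetric.ofRiemannian g).leviCivita x X Y Y X + 1| ≤ ε

/-- The hyperbolic reference volume `(8π²/3) ∫₀ᵗ sinh⁴ s ds` is nonnegative for `t ≥ 0`.
[folklore] -/
theorem hyperbolicBallVolumeFive_nonneg {t : ℝ} (ht : 0 ≤ t) :
    0 ≤ (8 * Real.pi ^ 2 / 3) * ∫ s in (0 : ℝ)..t, Real.sinh s ^ 4 := by
  have hint : 0 ≤ ∫ s in (0 : ℝ)..t, Real.sinh s ^ 4 :=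
    intervalIntegral.integral_nonneg ht fun s _ => by positivity
  positivity

/-- **Assembly (PROVED): Thm. 1.8 at `n = 5` from Thm. 1.5 and the curvature gap.** Given
`ε > 0`, take `δ'` from `liQingShi_curvatureGap_five` and `δ = min(δ'/2, 1)`; by
`liQingShi_volumeComparison_five` a Poincaré–Einstein filling with `Y(M,[g₀]) ≥ (1-δ)Y(S⁴)` has
volume ratio `≥ (1-δ)² ≥ 1-δ'`, hence `|K+1| ≤ ε` (the printed proof, pp. 12–13, with the Borel
σ-algebra of the bulk manufactured here). [cite: LiQingShi2017, Thm. 1.8 (proof, pp. 12–13)] -/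
theorem liQingShi_pinching_five_holds_of (h15 : liQingShi_volumeComparison_five)
    (hgap : liQingShi_curvatureGap_five) : liQingShi_pinching_five := by
  intro ε hε
  obtain ⟨δ', hδ', H⟩ := hgap ε hε
  refine ⟨min (δ' / 2) 1, lt_min (by positivity) one_pos, ?_⟩
  intro M _ _ _ _ _ _ _ _ _ g₀ N _ _ _ _ _ g _ hPE hY x X Y hX hYY hXY
  letI : MeasurableSpace N := borel N
  haveI : BorelSpace N := ⟨rfl⟩
  haveI : LocallyCompactSpace N := Manifold.locallyCompact_of_finiteDimensional (I := 𝓡 5)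
  haveI : T3Space N := inferInstance
  refine H M g₀ N g hPE ?_ x X Y hX hYY hXY
  intro p t ht
  have hvol := h15 (min (δ' / 2) 1) (lt_min (by positivity) one_pos) (min_le_right _ _) M g₀ N g
    hPE (fun h _ hconf => hY h hconf) p t ht
  refine le_trans (ENNReal.ofReal_le_ofReal ?_) hvol
  refine mul_le_mul_of_nonneg_right ?_ (hyperbolicBallVolumeFive_nonneg ht.le)
  have h1 : min (δ' / 2) 1 ≤ δ' / 2 := min_le_left _ _
  have h2 : 0 ≤ min (δ' / 2) 1 := (lt_min (by positivity) one_pos).le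
  nlinarith [sq_nonneg (min (δ' / 2) 1)]

end Literature.Geometry.Riemannian

end
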